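import Literature.NumberTheory.Automorphic.UnitaryLevelTwoLiftPieces          -- ★ p846479: `mem_cmLocalIntegralLevel_of_level`, `level_inv_of_level` (the `IsIntMatrix` level currency)
import Literature.NumberTheory.Automorphic.MatrixMoebiusShiftLevel           -- ★ p846642 N5a: `valued_moebius_sub_one_le_of_level`, `valued_moebius_scalar_sub_one_le_of_level`
import Literature.NumberTheory.Automorphic.AdicCompletionLocalField          -- ★ `L_w` is a non-archimedean local field (instances)
import Literature.NumberTheory.Automorphic.GLnCongruenceSubgroups            -- ★ `exists_congruenceGL_subset`, `mem_congruenceGL_iff`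
import Literature.NumberTheory.Automorphic.ParabolicInductionSupercuspidalProofs  -- ★ `exists_pow_mul_le`
import Literature.NumberTheory.Automorphic.CongruenceSubgroupExpansionGL     -- ★ `valBound_one_of_mem_glInt`
import Literature.NumberTheory.Automorphic.LocalUnitaryIntegralLevel         -- ★ `mem_localIntegralLevel_iff_of_smul_eq`
import Literature.NumberTheory.Automorphic.ValuedFieldValuativeRelBridge     -- ★ `v_le_iff_valuation_le`, `v_lt_iff_valuation_lt`
import Literature.NumberTheory.Rogawski1990.U3SupercuspidalJacquetVanishing  -- ★ `coe_localNonsplitEquiv_apply` (rfl)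
import Literature.NumberTheory.Rogawski1990.TypeTwoCayleyShiftCM             -- ★ `map_moebius`
import Literature.NumberTheory.Rogawski1990.FinExplicitTransferFactor        -- ★ `finGammaTwo`
import HarnessLib

/-!
# Congruence neighbourhoods of `1` in the CM unitary carriers, and the Cayley shift near `1` (organ (I), piece N5b)

Let `L∕L⁺` be CM, `v` a finite place of `L⁺` non-split in `L` (`w ∣ v`, `σ • w = w`).  The carrier `C_N = U(Φ_N)(L⁺_v)`
(`(cmDatum L N Φ_N).Local v`) is identified with `U(σ_w, Φ_{N,w})(L_w) ⊂ GL_N(L_w)` by the one-place model ★ `localNonsplitEquiv`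
(a topological-group isomorphism).  Hence the CONGRUENCE SETS «`x_w ≡ 1 (mod ϖ^j)`» form a neighbourhood basis of `1` in `C_N`
(★ `exists_congruenceGL_subset` in `GL_N(L_w)`), and on the endoscopic carrier `C₂ × C₁` every `V′ ∈ 𝓝 1` contains a congruence
box of some level `j ≥ 1`.  Combined with the level drop `j + 1 ↦ j` of the Cayley∕Möbius shift `φ_c` (★ N5a
`valued_moebius_sub_one_le_of_level`), this is the «`u_H → 1` as `γ_H → 1`» half of organ (I): a shifted pair `u_H = φ_c(γ_H)`
(componentwise matrix identities, the (A3) binders `h1`, `hu′`) lies in `V′` as soon as `γ_H` is congruent to `1` modulo `c_w^{j+1}`.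

**Main results.** `exists_level_forall_mem_of_mem_nhds_one` (one carrier, any `N`, `Φ`), `exists_level_forall_prod_mem_of_mem_nhds_one`
(the endoscopic carrier), `exists_level_forall_shift_mem_of_mem_nhds_one` (with the shift).

The print: [Rogawski1990] §4.9 Prop. 4.9.1 p. 55 (the germ at `1`: `γ_H → 1`); [Kottwitz1986] §3; [BernsteinZelevinsky1976] §1.1
(congruence subgroups are a basis of neighbourhoods of `1`); [PlatonovRapinchuk1994] §5.1 (the one-place model at a non-split place).

## References
* [Rogawski1990] J. Rogawski, *Automorphic Representations of Unitary Groups in Three Variables*, Ann. of Math. Stud. 123 (1990), §4.9 p. 55.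
* [Kottwitz1986] R. Kottwitz, *Base change for unit elements of Hecke algebras*, Compositio Math. 60 (1986), §3.
* [BernsteinZelevinsky1976] I. N. Bernstein, A. V. Zelevinsky, *Representations of the group GL(n,F) where F is a non-archimedean
  local field*, Russian Math. Surveys 31 (1976), §1.1.
* [PlatonovRapinchuk1994] V. Platonov, A. Rapinchuk, *Algebraic Groups and Number Theory* (1994), §5.1.
-/

set_option autoImplicit false

noncomputable section

open NumberField IsDedekindDomain Matrix ValuativeRel Topology Filter Set
open Literature.NumberTheory.Automorphic.UnitaryGroup Literature.NumberTheory.Automorphic.UnitaryLatticeTree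
open Literature.NumberTheory.Automorphic.HermitianLattice Literature.NumberTheory.Automorphic.MoebiusShift
open Literature.NumberTheory.Rogawski1990 Literature.NumberTheory.GaloisRepresentations
open scoped Matrix MatrixGroups ValuativeRel

namespace Literature.NumberTheory.Automorphic

section CarrierNhds

variable (L : Type) [Field L] [NumberField L] [IsCMField L]

set_option maxHeartbeats 400000 in
-- budget only: the one-place-model tokens; no search tactic runs long here.
/-- **Congruence sets are a neighbourhood basis of `1` in the carrier `U(Φ)(L⁺_v)`** (non-split `v`): for every `O ∈ 𝓝 1` there is
`j ≥ 1` with `{x : x_w ≡ 1 (mod ϖ^j)} ⊆ O` (`|ϖ| < 1`, `ϖ ≠ 0`; the level in the `IsIntMatrix` currency of ★ `UnitaryLevelTwoLiftPieces`).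
Transport of ★ `exists_congruenceGL_subset` along the homeomorphism ★ `localNonsplitEquiv`. [cite: BernsteinZelevinsky1976, §1.1]
[cite: PlatonovRapinchuk1994, §5.1] [cite: Kottwitz1986, §3] -/
theorem exists_level_forall_mem_of_mem_nhds_one (N : ℕ) (H : Matrix (Fin N) (Fin N) L)
    {v : HeightOneSpectrum (𝓞 ↥(maximalRealSubfield L))}
    (w : UnitaryGroup.PlacesOver L v) (hw : IsCMField.complexConj L • w.1 = w.1)
    {ϖ : (w.1.adicCompletion L)} (hϖ0 : ϖ ≠ 0) (hϖ1 : Valued.v ϖ < 1)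
    {O : Set ((cmDatum L N H).Local v)} (hO : O ∈ 𝓝 (1 : ((cmDatum L N H).Local v))) :
    ∃ j : ℕ, 1 ≤ j ∧ ∀ x : ((cmDatum L N H).Local v), IsIntMatrix ((ϖ ^ j)⁻¹ • (((((localNonsplitEquiv (IsCMField.complexConj L) H (IsCMField.complexConj_ne_one L) w hw x) : ↥(unitaryGroupOfForm (galAdicCompletionMap (L := L) (IsCMField.complexConj L) hw) (placeForm H w.1))) : GL (Fin N) (w.1.adicCompletion L)) : Matrix (Fin N) (Fin N) (w.1.adicCompletion L)) - 1)) → x ∈ O := by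
  classical
  have hc1 : IsCMField.complexConj L ≠ 1 := IsCMField.complexConj_ne_one L
  -- `O` read in `U(σ_w, Φ_w)(L_w)` and then in `GL_N(L_w)`
  have h1 : ((localNonsplitEquiv (IsCMField.complexConj L) H (IsCMField.complexConj_ne_one L) w hw)).symm ⁻¹' O ∈ 𝓝 (1 : ↥(unitaryGroupOfForm (galAdicCompletionMap (L := L) (IsCMField.complexConj L) hw) (placeForm H w.1))) := by
    have hO' : O ∈ 𝓝 (((localNonsplitEquiv (IsCMField.complexConj L) H (IsCMField.complexConj_ne_one L) w hw)).symm 1) := by rwa [map_one]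
    exact ((localNonsplitEquiv (IsCMField.complexConj L) H (IsCMField.complexConj_ne_one L) w hw)).symm.continuous.continuousAt.preimage_mem_nhds hO'
  obtain ⟨O', hO', hsub⟩ := (mem_nhds_induced Subtype.val (1 : ↥(unitaryGroupOfForm (galAdicCompletionMap (L := L) (IsCMField.complexConj L) hw) (placeForm H w.1))) (((localNonsplitEquiv (IsCMField.complexConj L) H (IsCMField.complexConj_ne_one L) w hw)).symm ⁻¹' O)).1 h1
  rw [OneMemClass.coe_one] at hO'
  obtain ⟨δ, hδ⟩ := exists_congruenceGL_subset hO'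
  -- the level `j`: `|ϖ|^(j) ≤ δ`
  have hγ0 : valuation (w.1.adicCompletion L) ϖ ≠ 0 := (Valuation.ne_zero_iff _).2 hϖ0
  have hγ1 : valuation (w.1.adicCompletion L) ϖ < 1 := (v_lt_one_iff_valuation_lt_one ϖ).1 hϖ1
  obtain ⟨j, hj⟩ := exists_pow_mul_le hγ0 hγ1 (valuation (w.1.adicCompletion L) ϖ) (Units.ne_zero δ)
  refine ⟨j + 1, Nat.succ_pos j, fun x hx => ?_⟩
  -- `x ∈ K`, hence `e x ∈ GL_N(𝒪_w)`
  have hxK : x ∈ cmLocalIntegralLevel L N H v := mem_cmLocalIntegralLevel_of_level L N H hc1 w hw hϖ0 hϖ1 (Nat.succ_pos j) x hx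
  have hxI : (((localNonsplitEquiv (IsCMField.complexConj L) H (IsCMField.complexConj_ne_one L) w hw x) : ↥(unitaryGroupOfForm (galAdicCompletionMap (L := L) (IsCMField.complexConj L) hw) (placeForm H w.1))) : GL (Fin N) (w.1.adicCompletion L)) ∈ glInt N (w.1.adicCompletion L) :=
    (mem_localIntegralLevel_iff_of_smul_eq (IsCMField.complexConj L) N H hc1 w hw x).1 hxK
  have hxinv := level_inv_of_level L N H hc1 w hw hϖ0 hϖ1 (Nat.succ_pos j) x hx
  have hpow : valuation (w.1.adicCompletion L) (ϖ ^ (j + 1)) = valuation (w.1.adicCompletion L) ϖ ^ (j + 1) := map_pow _ _ _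
  have hbound : ∀ M : Matrix (Fin N) (Fin N) (w.1.adicCompletion L), IsIntMatrix ((ϖ ^ (j + 1))⁻¹ • M) →
      ValBound (valuation (w.1.adicCompletion L) ϖ ^ (j + 1)) M := fun M hM a b => by
    rw [← hpow]
    exact (v_le_iff_valuation_le _ _).1 ((isIntMatrix_inv_smul_iff (pow_ne_zero _ hϖ0) M).1 hM a b)
  have hmem : (((localNonsplitEquiv (IsCMField.complexConj L) H (IsCMField.complexConj_ne_one L) w hw x) : ↥(unitaryGroupOfForm (galAdicCompletionMap (L := L) (IsCMField.complexConj L) hw) (placeForm H w.1))) : GL (Fin N) (w.1.adicCompletion L)) ∈ congruenceGL N (valuation (w.1.adicCompletion L) ϖ ^ (j + 1)) := by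
    rw [mem_congruenceGL_iff]
    refine ⟨⟨valBound_one_of_mem_glInt hxI, valBound_one_of_mem_glInt (inv_mem hxI)⟩, hbound _ hx, ?_⟩
    have hcoe : ((((localNonsplitEquiv (IsCMField.complexConj L) H (IsCMField.complexConj_ne_one L) w hw x) : ↥(unitaryGroupOfForm (galAdicCompletionMap (L := L) (IsCMField.complexConj L) hw) (placeForm H w.1))) : GL (Fin N) (w.1.adicCompletion L))⁻¹ : GL (Fin N) (w.1.adicCompletion L)) =
        (((localNonsplitEquiv (IsCMField.complexConj L) H (IsCMField.complexConj_ne_one L) w hw x⁻¹) : ↥(unitaryGroupOfForm (galAdicCompletionMap (L := L) (IsCMField.complexConj L) hw) (placeForm H w.1))) : GL (Fin N) (w.1.adicCompletion L)) := by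
      rw [map_inv]; rfl
    rw [hcoe]; exact hbound _ hxinv
  have hle : valuation (w.1.adicCompletion L) ϖ ^ (j + 1) ≤ (δ : ValueGroupWithZero (w.1.adicCompletion L)) := by
    rw [pow_succ]; exact hj
  have hO'mem : (((localNonsplitEquiv (IsCMField.complexConj L) H (IsCMField.complexConj_ne_one L) w hw x) : ↥(unitaryGroupOfForm (galAdicCompletionMap (L := L) (IsCMField.complexConj L) hw) (placeForm H w.1))) : GL (Fin N) (w.1.adicCompletion L)) ∈ O' := hδ (congruenceGL_mono hle hmem)
  have hpre : (localNonsplitEquiv (IsCMField.complexConj L) H (IsCMField.complexConj_ne_one L) w hw x) ∈ ((localNonsplitEquiv (IsCMField.complexConj L) H (IsCMField.complexConj_ne_one L) w hw)).symm ⁻¹' O := hsub hO'mem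
  have hxx : ((localNonsplitEquiv (IsCMField.complexConj L) H (IsCMField.complexConj_ne_one L) w hw)).symm (localNonsplitEquiv (IsCMField.complexConj L) H (IsCMField.complexConj_ne_one L) w hw x) = x := ((localNonsplitEquiv (IsCMField.complexConj L) H (IsCMField.complexConj_ne_one L) w hw)).symm_apply_apply x
  rw [Set.mem_preimage, hxx] at hpre
  exact hpre

set_option maxHeartbeats 400000 in
-- budget only: the one-place-model tokens; no search tactic runs long here.
/-- **On the endoscopic carrier `U(Φ₂)(L⁺_v) × U(Φ₁)(L⁺_v)` every neighbourhood of `1` contains a congruence box**: for `V′ ∈ 𝓝 1`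
there is `j ≥ 1` such that `u_H ∈ V′` whenever both components satisfy `(u_H)_w ≡ 1 (mod ϖ^j)`. [cite: BernsteinZelevinsky1976, §1.1]
[cite: Rogawski1990, §4.9 Prop. 4.9.1 p. 55] -/
theorem exists_level_forall_prod_mem_of_mem_nhds_one
    {v : HeightOneSpectrum (𝓞 ↥(maximalRealSubfield L))}
    (w : UnitaryGroup.PlacesOver L v) (hw : IsCMField.complexConj L • w.1 = w.1)
    {ϖ : (w.1.adicCompletion L)} (hϖ0 : ϖ ≠ 0) (hϖ1 : Valued.v ϖ < 1)
    {V' : Set (((cmDatum L 2 (Matrix.of fun i j : Fin 2 => if i.val + j.val + 1 = 2 then (1 : L) else 0)).Local v) × ((cmDatum L 1 (Matrix.of fun i j : Fin 1 => if i.val + j.val + 1 = 1 then (1 : L) else 0)).Local v))} (hV' : V' ∈ 𝓝 (1 : (((cmDatum L 2 (Matrix.of fun i j : Fin 2 => if i.val + j.val + 1 = 2 then (1 : L) else 0)).Local v) × ((cmDatum L 1 (Matrix.of fun i j : Fin 1 => if i.val + j.val + 1 = 1 then (1 : L) else 0)).Local v)))) :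
    ∃ j : ℕ, 1 ≤ j ∧ ∀ uH : (((cmDatum L 2 (Matrix.of fun i j : Fin 2 => if i.val + j.val + 1 = 2 then (1 : L) else 0)).Local v) × ((cmDatum L 1 (Matrix.of fun i j : Fin 1 => if i.val + j.val + 1 = 1 then (1 : L) else 0)).Local v)),
      IsIntMatrix ((ϖ ^ j)⁻¹ • (((((localNonsplitEquiv (IsCMField.complexConj L) (Matrix.of fun i j : Fin 2 => if i.val + j.val + 1 = 2 then (1 : L) else 0) (IsCMField.complexConj_ne_one L) w hw uH.1) : ↥(unitaryGroupOfForm (galAdicCompletionMap (L := L) (IsCMField.complexConj L) hw) (placeForm (Matrix.of fun i j : Fin 2 => if i.val + j.val + 1 = 2 then (1 : L) else 0) w.1))) : GL (Fin 2) (w.1.adicCompletion L)) : Matrix (Fin 2) (Fin 2) (w.1.adicCompletion L)) - 1)) →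
      IsIntMatrix ((ϖ ^ j)⁻¹ • (((((localNonsplitEquiv (IsCMField.complexConj L) (Matrix.of fun i j : Fin 1 => if i.val + j.val + 1 = 1 then (1 : L) else 0) (IsCMField.complexConj_ne_one L) w hw uH.2) : ↥(unitaryGroupOfForm (galAdicCompletionMap (L := L) (IsCMField.complexConj L) hw) (placeForm (Matrix.of fun i j : Fin 1 => if i.val + j.val + 1 = 1 then (1 : L) else 0) w.1))) : GL (Fin 1) (w.1.adicCompletion L)) : Matrix (Fin 1) (Fin 1) (w.1.adicCompletion L)) - 1)) → uH ∈ V' := by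
  have hV'' : V' ∈ 𝓝 ((1 : ((cmDatum L 2 (Matrix.of fun i j : Fin 2 => if i.val + j.val + 1 = 2 then (1 : L) else 0)).Local v)), (1 : ((cmDatum L 1 (Matrix.of fun i j : Fin 1 => if i.val + j.val + 1 = 1 then (1 : L) else 0)).Local v))) := hV'
  obtain ⟨V₂, hV₂, V₁, hV₁, hsub⟩ := mem_nhds_prod_iff.1 hV''
  obtain ⟨j₂, hj₂, h₂⟩ := exists_level_forall_mem_of_mem_nhds_one L 2 (Matrix.of fun i j : Fin 2 => if i.val + j.val + 1 = 2 then (1 : L) else 0) w hw hϖ0 hϖ1 hV₂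
  obtain ⟨j₁, -, h₁⟩ := exists_level_forall_mem_of_mem_nhds_one L 1 (Matrix.of fun i j : Fin 1 => if i.val + j.val + 1 = 1 then (1 : L) else 0) w hw hϖ0 hϖ1 hV₁
  -- a common level `j = max j₂ j₁`: deeper levels imply shallower ones
  have hϖv1 : Valued.v ϖ ≤ 1 := hϖ1.le
  have hmono : ∀ (M : ℕ) (A : Matrix (Fin M) (Fin M) (w.1.adicCompletion L)) (i k : ℕ), i ≤ k →
      IsIntMatrix ((ϖ ^ k)⁻¹ • A) → IsIntMatrix ((ϖ ^ i)⁻¹ • A) := fun M A i k hik hA => by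
    refine (isIntMatrix_inv_smul_iff (pow_ne_zero _ hϖ0) A).2 fun a' b' => ?_
    refine ((isIntMatrix_inv_smul_iff (pow_ne_zero _ hϖ0) A).1 hA a' b').trans ?_
    rw [Valuation.map_pow, Valuation.map_pow]
    exact pow_le_pow_right_of_le_one' hϖv1 hik
  refine ⟨max j₂ j₁, le_max_of_le_left hj₂, fun uH hu2 hu1 => hsub (Set.mk_mem_prod ?_ ?_)⟩
  · exact h₂ uH.1 (hmono _ _ _ _ (le_max_left _ _) hu2)
  · exact h₁ uH.2 (hmono _ _ _ _ (le_max_right _ _) hu1)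

set_option maxHeartbeats 800000 in
-- budget only: one statement-heavy declaration (the (A3) shift binders); no search tactic runs long here.
/-- **«`u_H → 1` as `γ_H → 1`» for the Cayley shift** (organ (I), N5b): given `V′ ∈ 𝓝 1` in the endoscopic carrier there is `j ≥ 1`
such that every pair `(γ_H, u_H)` with `u_H = φ_c(γ_H)` componentwise (the (A3) binders `h1`, `hu′`: `g′ = ((c+1)g + (c−1))((c−1)g + (c+1))⁻¹`,
`u′ = ((c+1)u + (c−1))·((c−1)u + (c+1))⁻¹`, denominators invertible) and `γ_H` congruent to `1` modulo `c_w^{j+1}` at `w` (`g_w`, `u_w`)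
has `u_H ∈ V′` — the shift loses exactly one level (★ `valued_moebius_sub_one_le_of_level`, ★ `valued_moebius_scalar_sub_one_le_of_level`;
`|c_w| = exp(−1)`, `|2|_w = 1`). [cite: Rogawski1990, §4.9 Prop. 4.9.1 p. 55] [cite: Kottwitz1986, §3] -/
theorem exists_level_forall_shift_mem_of_mem_nhds_one
    {v : HeightOneSpectrum (𝓞 ↥(maximalRealSubfield L))}
    (w : UnitaryGroup.PlacesOver L v) (hw : IsCMField.complexConj L • w.1 = w.1)
    {c : LocalRing L v} (hc : Valued.v (c w) = WithZero.exp (-1 : ℤ)) (h2 : Valued.v (2 : (w.1.adicCompletion L)) = 1)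
    {V' : Set (((cmDatum L 2 (Matrix.of fun i j : Fin 2 => if i.val + j.val + 1 = 2 then (1 : L) else 0)).Local v) × ((cmDatum L 1 (Matrix.of fun i j : Fin 1 => if i.val + j.val + 1 = 1 then (1 : L) else 0)).Local v))} (hV' : V' ∈ 𝓝 (1 : (((cmDatum L 2 (Matrix.of fun i j : Fin 2 => if i.val + j.val + 1 = 2 then (1 : L) else 0)).Local v) × ((cmDatum L 1 (Matrix.of fun i j : Fin 1 => if i.val + j.val + 1 = 1 then (1 : L) else 0)).Local v)))) :
    ∃ j : ℕ, 1 ≤ j ∧ ∀ γH uH : (((cmDatum L 2 (Matrix.of fun i j : Fin 2 => if i.val + j.val + 1 = 2 then (1 : L) else 0)).Local v) × ((cmDatum L 1 (Matrix.of fun i j : Fin 1 => if i.val + j.val + 1 = 1 then (1 : L) else 0)).Local v)),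
      (∀ i k, Valued.v (((((γH.1.val : GL (Fin 2) (LocalRing L v)).val : Matrix (Fin 2) (Fin 2) (LocalRing L v))).map (Pi.evalRingHom (fun w' : UnitaryGroup.PlacesOver L v => w'.1.adicCompletion L) w) - 1) i k) ≤ Valued.v (c w) ^ (j + 1)) →
      Valued.v (finGammaTwo L v γH w - 1) ≤ Valued.v (c w) ^ (j + 1) →
      IsUnit ((c - 1) • ((γH.1.val : GL (Fin 2) (LocalRing L v)).val : Matrix (Fin 2) (Fin 2) (LocalRing L v)) + (c + 1) • (1 : Matrix (Fin 2) (Fin 2) (LocalRing L v))).det →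
      IsUnit ((c - 1) * finGammaTwo L v γH + (c + 1)) →
      ((uH.1.val : GL (Fin 2) (LocalRing L v)).val : Matrix (Fin 2) (Fin 2) (LocalRing L v)) =
        ((c + 1) • ((γH.1.val : GL (Fin 2) (LocalRing L v)).val : Matrix (Fin 2) (Fin 2) (LocalRing L v)) + (c - 1) • 1) *
          ((c - 1) • ((γH.1.val : GL (Fin 2) (LocalRing L v)).val : Matrix (Fin 2) (Fin 2) (LocalRing L v)) + (c + 1) • 1)⁻¹ →
      finGammaTwo L v uH = ((c + 1) * finGammaTwo L v γH + (c - 1)) * Ring.inverse ((c - 1) * finGammaTwo L v γH + (c + 1)) →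
      uH ∈ V' := by
  classical
  have hc0 : c w ≠ 0 := fun h => by rw [h, map_zero] at hc; exact WithZero.zero_ne_coe hc
  have hc1' : Valued.v (c w) < 1 := by
    rw [hc, ← WithZero.exp_zero]; exact WithZero.exp_lt_exp.2 (by norm_num)
  obtain ⟨j, hj, hV⟩ := exists_level_forall_prod_mem_of_mem_nhds_one L w hw hc0 hc1' hV'
  refine ⟨j, hj, fun γH uH hg hu hD hU h1 hu' => hV uH ?_ ?_⟩
  · -- the `U(Φ₂)`-component: `(u_H.1)_w = φ_{c_w}(g_w)` loses one level
    have hmat : ((((localNonsplitEquiv (IsCMField.complexConj L) (Matrix.of fun i j : Fin 2 => if i.val + j.val + 1 = 2 then (1 : L) else 0) (IsCMField.complexConj_ne_one L) w hw uH.1) : ↥(unitaryGroupOfForm (galAdicCompletionMap (L := L) (IsCMField.complexConj L) hw) (placeForm (Matrix.of fun i j : Fin 2 => if i.val + j.val + 1 = 2 then (1 : L) else 0) w.1))) : GL (Fin 2) (w.1.adicCompletion L)) : Matrix (Fin 2) (Fin 2) (w.1.adicCompletion L)) =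
        ((c w + 1) • (((γH.1.val : GL (Fin 2) (LocalRing L v)).val : Matrix (Fin 2) (Fin 2) (LocalRing L v))).map (Pi.evalRingHom (fun w' : UnitaryGroup.PlacesOver L v => w'.1.adicCompletion L) w) + (c w - 1) • (1 : Matrix (Fin 2) (Fin 2) (w.1.adicCompletion L))) *
          ((c w - 1) • (((γH.1.val : GL (Fin 2) (LocalRing L v)).val : Matrix (Fin 2) (Fin 2) (LocalRing L v))).map (Pi.evalRingHom (fun w' : UnitaryGroup.PlacesOver L v => w'.1.adicCompletion L) w) + (c w + 1) • (1 : Matrix (Fin 2) (Fin 2) (w.1.adicCompletion L)))⁻¹ := by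
      rw [coe_localNonsplitEquiv_apply L (Matrix.of fun i j : Fin 2 => if i.val + j.val + 1 = 2 then (1 : L) else 0) v w hw uH.1]
      show (((uH.1.val : GL (Fin 2) (LocalRing L v)).val : Matrix (Fin 2) (Fin 2) (LocalRing L v))).map (Pi.evalRingHom (fun w' : UnitaryGroup.PlacesOver L v => w'.1.adicCompletion L) w) = _
      rw [h1, map_moebius (Pi.evalRingHom (fun w' : UnitaryGroup.PlacesOver L v => w'.1.adicCompletion L) w) _ _ _ hD, map_add, map_sub, map_one]
      rfl
    have hlev := (valued_moebius_sub_one_le_of_level h2 hc ((((γH.1.val : GL (Fin 2) (LocalRing L v)).val : Matrix (Fin 2) (Fin 2) (LocalRing L v))).map (Pi.evalRingHom (fun w' : UnitaryGroup.PlacesOver L v => w'.1.adicCompletion L) w)) hj hg).1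
    refine (isIntMatrix_inv_smul_iff (pow_ne_zero _ hc0) _).2 fun a b => ?_
    rw [Valuation.map_pow, hmat]
    exact hlev a b
  · -- the `U(Φ₁)`-component: the entry `γ₂(u_H)_w = φ_{c_w}(γ₂(γ_H)_w)`
    have hmul : finGammaTwo L v uH * ((c - 1) * finGammaTwo L v γH + (c + 1)) = (c + 1) * finGammaTwo L v γH + (c - 1) := by
      rw [hu', mul_assoc, Ring.inverse_mul_cancel _ hU, mul_one]
    have hw' : finGammaTwo L v uH w * ((c w - 1) * finGammaTwo L v γH w + (c w + 1)) =
        (c w + 1) * finGammaTwo L v γH w + (c w - 1) := by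
      have h := congrArg (fun f : LocalRing L v => f w) hmul
      simpa only [Pi.mul_apply, Pi.add_apply, Pi.sub_apply, Pi.one_apply] using h
    have hden : (c w - 1) * finGammaTwo L v γH w + (c w + 1) ≠ 0 := by
      obtain ⟨u, hu0⟩ := hU
      intro h0
      have h1' : ((u : LocalRing L v) w) * (((u⁻¹ : (LocalRing L v)ˣ) : LocalRing L v) w) = 1 := by
        have h := congrArg (fun f : LocalRing L v => f w) u.mul_inv
        simpa only [Pi.mul_apply, Pi.one_apply] using h
      have hcw : (u : LocalRing L v) w = (c w - 1) * finGammaTwo L v γH w + (c w + 1) := by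
        rw [hu0]; simp only [Pi.mul_apply, Pi.add_apply, Pi.sub_apply, Pi.one_apply]
      rw [hcw, h0, zero_mul] at h1'
      exact zero_ne_one h1'
    have huw : finGammaTwo L v uH w =
        ((c w + 1) * finGammaTwo L v γH w + (c w - 1)) / ((c w - 1) * finGammaTwo L v γH w + (c w + 1)) := by
      rw [eq_div_iff hden]; exact hw'
    have hlev := (valued_moebius_scalar_sub_one_le_of_level h2 hc (finGammaTwo L v γH w) hj hu).1
    refine (isIntMatrix_inv_smul_iff (pow_ne_zero _ hc0) _).2 fun a b => ?_
    have ha : a = 0 := Subsingleton.elim _ _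
    have hb : b = 0 := Subsingleton.elim _ _
    subst ha; subst hb
    rw [Valuation.map_pow, Matrix.sub_apply, coe_localNonsplitEquiv_apply L (Matrix.of fun i j : Fin 1 => if i.val + j.val + 1 = 1 then (1 : L) else 0) v w hw uH.2, Matrix.one_apply_eq]
    show Valued.v (finGammaTwo L v uH w - 1) ≤ _
    rw [huw]; exact hlev

end CarrierNhds

end Literature.NumberTheory.Automorphic
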